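import Mathlib
import HarnessLib
import Literature.Geometry.DiscreteGeometry.KissingPatterns
import Literature.Probability.Process.PointStationaryLaw

/-!
# Crux `AperiodicFrustratedLawGap` — TEXTURE TRANSFER I: fine shells are dense in the charged configuration itself

Route `FrustratedLawDichotomy` (and `PeriodicChargeSplit`), crux `AperiodicFrustratedLawGap`
(item `stmt-AtomisticToContinuum-27623`), skeleton `dd3251ad731e`; hand-1 lane (direct consequences of the crux's own
hypotheses), generation 4.

The texture clause (d) of the crux speaks about FINITE APPROXIMANTS: around every atom `q` of almost every configuration
`μ`, at every radius `R` and tolerance `ε > 0`, the atoms of `μ` in the `R`-ball of `q` are two-way `ε`-matched (after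
re-centring) by a finite `7/10`-separated configuration `y` whose `R`-ball is all-`1/20`-bad and TEXTURED; clause (4) of
the texture says that every site of that ball has a `1/8`-GOOD site within `R₈` (its `13/10`-shell is, after rescaling by
the nearest-neighbour distance and a linear isometry, within `1/8` of the fcc or the hcp kissing pattern, bijectively).
Goodness is not a closed condition (shell-boundary and tolerance-boundary cases), so it does not pass to `μ` verbatim; what
DOES pass, for every slack `ε > 0`, is its two-sided metric content.  This file proves the transfer:

* `shell_transfer_core` — the bookkeeping engine: a matched good site of an approximant hands its rescaled pattern to the
  matched atom of `μ`, one-sidedly (every pattern point has an atom within `d/8 + ε`) and two-sidedly (every atom of the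
  punctured `(13/10·d − ε)`-ball of the carrier is within `d/8 + ε` of a pattern point), together with the nearest-neighbour
  reading of the scale `d` (`d ≤ dist s p' + ε` for every other atom `s`, and `7/10 ≤ d`);
* `fineShell_of_texture` — deterministic: a rooted hard-core configuration with at least two atoms that is texture-charged
  in the sense of clause (d) (only separation, clause (4) and the two matching clauses are used) has, within `R₈ + ε` of
  EVERY atom, an atom `p'` carrying such an `(1/8 + ε)`-fcc/hcp shell at a scale `d ≥ 7/10` that is its nearest-neighbour
  distance up to `ε`;
* `ae_fineShell_of_texture` — the law-level reading with the crux's `let`-bound `Gy`/`TexBall`/`Appr` VERBATIM: clauses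
  (a) + (d) of `AperiodicFrustratedLawGap` give the above almost surely, for every `ε > 0` and every pair of distinct atoms.

(Single-atom configurations are excluded by clause (d) itself for `R > max R₈ R₉`; the two-atom hypothesis is the form
consumers have after hand-2's infinite-case cut `aperiodicErgodicGap_iff_infiniteCase`.)  This is the first almost-sure
CONFIGURATION-LEVEL consequence of clause (d) beyond the hard-core upgrade (`FrustratedLawDichotomyHardCoreUpgrade`,
p796363): fine (close-packed up to `1/8`) sites are `R₈`-dense in the charged configuration — the «density of marks» input
shape of the marked transport door (`FrustratedLawDichotomyTransportPriceMarked`, p799844) and of the grain/core geometry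
of the child route `GrainCoreNetworkSplit`.  `[folklore]` (elementary metric bookkeeping; no literature content).
-/

noncomputable section

namespace Summit.AtomisticToContinuum.Crystallization.Theorems.FrustratedLawDichotomyTextureFineShells

open MeasureTheory Literature.Probability.Process Literature.Geometry.DiscreteGeometry

/-- `‖v − d•w‖ = d · dist (d⁻¹•v) w` for `d > 0`. [folklore] -/
theorem norm_sub_smul_eq {d : ℝ} (hd : 0 < d) (v w : EuclideanSpace ℝ (Fin 3)) :
    ‖v - d • w‖ = d * dist (d⁻¹ • v) w := by
  symm
  calc d * dist (d⁻¹ • v) w = ‖d • (d⁻¹ • v - w)‖ := by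
        rw [norm_smul, Real.norm_eq_abs, abs_of_pos hd, dist_eq_norm]
    _ = ‖v - d • w‖ := by rw [smul_sub, smul_inv_smul₀ hd.ne']

/-- The fcc kissing pattern is non-empty (it has 12 points). [folklore] -/
theorem fccKissingPattern_nonempty : fccKissingPattern.Nonempty := by
  rw [← Finset.card_pos, card_fccKissingPattern]; norm_num

/-- The hcp kissing pattern is non-empty (it has 12 points). [folklore] -/
theorem hcpKissingPattern_nonempty : hcpKissingPattern.Nonempty := by
  rw [← Finset.card_pos, card_hcpKissingPattern]; norm_num

/-- **Shell-transfer engine.**  Data: a `δ`-separated set `S ∋ p, p'` (`δ > 0`); a finite `7/10`-separated configuration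
`y` with centre `y i`, two-way `ε'`-matched to `S` re-centred at `p` inside radius `R` (atoms ↦ points and points ↦ atoms);
a site `k` with `dist (y k) (y i) ≤ R₈` matched to `p'`; an upper bound `B` for the nearest-neighbour distance
`d = sInf {dist z (y k) | z ∈ range y ∖ {y k}}` of `k` with `13/10·B + B + R₈ + 1 ≤ R`; and a bijection `e` from the punctured
`13/10·d`-shell of `y k` onto a non-empty pattern `Pat`, `1/8`-close after rescaling by `d⁻¹` and the linear isometry `A`.
Conclusion (with `0 < ε`, `4ε' ≤ ε`, `2ε' < δ`): `7/10 ≤ d`; `d ≤ dist s p' + ε` for every atom `s ≠ p'`; every pattern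
point `u` has an atom `s` with `dist (s − p') (d•A u) ≤ d/8 + ε`; and every atom `s ≠ p'` with `dist s p' + ε ≤ 13/10·d` is
within `d/8 + ε` of some `d•A u`, `u ∈ Pat` (relative to `p'`). [folklore] -/
theorem shell_transfer_core {S : Set (EuclideanSpace ℝ (Fin 3))} {δ : ℝ}
    (hS : ∀ x ∈ S, ∀ x' ∈ S, x ≠ x' → δ ≤ dist x x')
    {N : ℕ} {y : Fin N → EuclideanSpace ℝ (Fin 3)} {i k : Fin N} {p p' : EuclideanSpace ℝ (Fin 3)}
    {R R₈ ε ε' B : ℝ}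
    (hsepY : ∀ a b : Fin N, a ≠ b → (7 : ℝ) / 10 ≤ dist (y a) (y b))
    (hm1 : ∀ s ∈ S, dist s p ≤ R → ∃ a : Fin N, dist (y a - y i) (s - p) ≤ ε')
    (hm2 : ∀ a : Fin N, dist (y a) (y i) ≤ R → ∃ s ∈ S, dist (y a - y i) (s - p) ≤ ε')
    (hp' : p' ∈ S) (hk : dist (y k - y i) (p' - p) ≤ ε') (hki : dist (y k) (y i) ≤ R₈)
    (hε : 0 < ε) (h2ε' : 2 * ε' < δ) (h4ε' : 4 * ε' ≤ ε)
    {dk : ℝ} (hdk : dk = sInf ((fun z => dist z (y k)) '' (Set.range y \ {y k}))) (hB : dk ≤ B) (hR : 13 / 10 * B + B + R₈ + 1 ≤ R)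
    {Pat : Finset (EuclideanSpace ℝ (Fin 3))} (hPat : Pat.Nonempty)
    {A : EuclideanSpace ℝ (Fin 3) →ₗᵢ[ℝ] EuclideanSpace ℝ (Fin 3)}
    (e : ↥{z : EuclideanSpace ℝ (Fin 3) | z ∈ Set.range y ∧ z ≠ y k ∧ dist z (y k) < 13 / 10 * dk} ≃ ↥Pat)
    (he : ∀ t : ↥{z : EuclideanSpace ℝ (Fin 3) | z ∈ Set.range y ∧ z ≠ y k ∧ dist z (y k) < 13 / 10 * dk},
      dist (dk⁻¹ • ((t : EuclideanSpace ℝ (Fin 3)) - y k)) (A ((e t : ↥Pat) : EuclideanSpace ℝ (Fin 3))) ≤ 1 / 8) :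
    (7 : ℝ) / 10 ≤ dk ∧
    (∀ s ∈ S, s ≠ p' → dk ≤ dist s p' + ε) ∧
    (∀ u ∈ Pat, ∃ s ∈ S, dist (s - p') (dk • A u) ≤ dk / 8 + ε) ∧
    (∀ s ∈ S, s ≠ p' → dist s p' + ε ≤ 13 / 10 * dk → ∃ u ∈ Pat, dist (s - p') (dk • A u) ≤ dk / 8 + ε) := by
  have hε'0 : 0 ≤ ε' := by
    have := hk; exact le_trans dist_nonneg this
  -- the distance set of `k` is non-empty (the shell is in bijection with the non-empty pattern) and bounded below
  obtain ⟨u₀, hu₀⟩ := hPat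
  have hDne : ((fun z => dist z (y k)) '' (Set.range y \ {y k})).Nonempty := by
    set t₀ := e.symm ⟨u₀, hu₀⟩ with ht₀
    exact ⟨dist (t₀ : EuclideanSpace ℝ (Fin 3)) (y k), (t₀ : EuclideanSpace ℝ (Fin 3)), ⟨t₀.2.1, t₀.2.2.1⟩, rfl⟩
  have hDbdd : BddBelow ((fun z => dist z (y k)) '' (Set.range y \ {y k})) :=
    ⟨0, by rintro b ⟨z, -, rfl⟩; exact dist_nonneg⟩
  have hdk7 : (7 : ℝ) / 10 ≤ dk := by
    rw [hdk]
    refine le_csInf hDne ?_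
    rintro b ⟨z, ⟨⟨a, rfl⟩, hz⟩, rfl⟩
    exact hsepY a k (fun h => hz (by rw [h]; rfl))
  have hdkpos : 0 < dk := by linarith
  have hdk_le : ∀ a : Fin N, y a ≠ y k → dk ≤ dist (y a) (y k) :=
    fun a ha => hdk ▸ csInf_le hDbdd ⟨y a, ⟨⟨a, rfl⟩, ha⟩, rfl⟩
  -- `dist p' p ≤ R₈ + ε'`
  have hp'p : dist p' p ≤ R₈ + ε' := by
    rw [dist_eq_norm]
    calc ‖p' - p‖ = ‖((p' - p) - (y k - y i)) + (y k - y i)‖ := by congr 1; abel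
      _ ≤ ‖(p' - p) - (y k - y i)‖ + ‖y k - y i‖ := norm_add_le _ _
      _ ≤ ε' + R₈ := add_le_add (by rw [← dist_eq_norm, dist_comm]; exact hk) (by rw [← dist_eq_norm]; exact hki)
      _ = R₈ + ε' := by ring
  -- the two-centre re-centring identity
  have key : ∀ (a : Fin N) (s : EuclideanSpace ℝ (Fin 3)), dist (y a - y i) (s - p) ≤ ε' →
      ‖(s - p') - (y a - y k)‖ ≤ 2 * ε' := by
    intro a s h
    have hid : (s - p') - (y a - y k) = ((s - p) - (y a - y i)) - ((p' - p) - (y k - y i)) := by abel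
    rw [hid]
    calc ‖((s - p) - (y a - y i)) - ((p' - p) - (y k - y i))‖
        ≤ ‖(s - p) - (y a - y i)‖ + ‖(p' - p) - (y k - y i)‖ := norm_sub_le _ _
      _ ≤ ε' + ε' := by
          rw [← dist_eq_norm, ← dist_eq_norm, dist_comm (s - p), dist_comm (p' - p)]
          exact add_le_add h hk
      _ = 2 * ε' := by ring
  have far : ∀ (a : Fin N) (s : EuclideanSpace ℝ (Fin 3)), s ∈ S → s ≠ p' → dist (y a - y i) (s - p) ≤ ε' →
      y a ≠ y k := by
    intro a s hs hne h heq
    have h1 := key a s h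
    rw [heq, sub_self, sub_zero, ← dist_eq_norm] at h1
    have h2 := hS s hs p' hp' hne
    linarith
  -- one term of the shell: rescaled closeness
  have hclose : ∀ t : ↥{z : EuclideanSpace ℝ (Fin 3) | z ∈ Set.range y ∧ z ≠ y k ∧ dist z (y k) < 13 / 10 * dk},
      ‖((t : EuclideanSpace ℝ (Fin 3)) - y k) - dk • A ((e t : ↥Pat) : EuclideanSpace ℝ (Fin 3))‖ ≤ dk / 8 := by
    intro t
    rw [norm_sub_smul_eq hdkpos]
    calc dk * dist (dk⁻¹ • ((t : EuclideanSpace ℝ (Fin 3)) - y k)) (A ((e t : ↥Pat) : EuclideanSpace ℝ (Fin 3)))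
        ≤ dk * (1 / 8) := mul_le_mul_of_nonneg_left (he t) hdkpos.le
      _ = dk / 8 := by ring
  refine ⟨hdk7, ?_, ?_, ?_⟩
  · -- nearest-neighbour reading of the scale
    intro s hs hne
    by_cases hsR : dist s p ≤ R
    · obtain ⟨a, ha⟩ := hm1 s hs hsR
      have hak := far a s hs hne ha
      have h1 := hdk_le a hak
      have h2 := key a s ha
      have h3 : dist (y a) (y k) ≤ dist s p' + 2 * ε' := by
        rw [dist_eq_norm, dist_eq_norm]
        calc ‖y a - y k‖ = ‖(s - p') - ((s - p') - (y a - y k))‖ := by congr 1; abel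
          _ ≤ ‖s - p'‖ + ‖(s - p') - (y a - y k)‖ := norm_sub_le _ _
          _ ≤ ‖s - p'‖ + 2 * ε' := by linarith
      linarith
    · push Not at hsR
      have h1 : dist s p ≤ dist s p' + dist p' p := dist_triangle _ _ _
      have hB0 : dk ≤ B := hB
      have hR₈' : dist p' p ≤ R₈ + ε' := hp'p
      linarith
  · -- one-sided: every pattern point is carried by an atom
    intro u hu
    set t := e.symm ⟨u, hu⟩ with ht
    obtain ⟨⟨a, ha⟩, hne, hlt⟩ := t.2
    have haR : dist (y a) (y i) ≤ R := by
      have h1 : dist (y a) (y i) ≤ dist (y a) (y k) + dist (y k) (y i) := dist_triangle _ _ _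
      rw [ha] at h1 ⊢
      have hlt' : dist (t : EuclideanSpace ℝ (Fin 3)) (y k) < 13 / 10 * dk := hlt
      nlinarith [hB, hdkpos]
    obtain ⟨s, hs, hsa⟩ := hm2 a haR
    refine ⟨s, hs, ?_⟩
    have h2 := key a s hsa
    rw [ha] at h2
    have h3 := hclose t
    have het : ((e t : ↥Pat) : EuclideanSpace ℝ (Fin 3)) = u := by rw [ht, Equiv.apply_symm_apply]
    rw [het] at h3
    rw [dist_eq_norm]
    calc ‖(s - p') - dk • A u‖ = ‖((s - p') - ((t : EuclideanSpace ℝ (Fin 3)) - y k)) + (((t : EuclideanSpace ℝ (Fin 3)) - y k) - dk • A u)‖ := by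
          congr 1; abel
      _ ≤ ‖(s - p') - ((t : EuclideanSpace ℝ (Fin 3)) - y k)‖ + ‖((t : EuclideanSpace ℝ (Fin 3)) - y k) - dk • A u‖ := norm_add_le _ _
      _ ≤ 2 * ε' + dk / 8 := add_le_add h2 h3
      _ ≤ dk / 8 + ε := by linarith
  · -- two-sided: every atom of the punctured `(13/10·d − ε)`-ball sits at a pattern point
    intro s hs hne hsd
    have hsR : dist s p ≤ R := by
      have h1 : dist s p ≤ dist s p' + dist p' p := dist_triangle _ _ _
      have hε0 : 0 ≤ ε := by linarith
      nlinarith [hB, hp'p, hdkpos]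
    obtain ⟨a, ha⟩ := hm1 s hs hsR
    have hak := far a s hs hne ha
    have h2 := key a s ha
    have halt : dist (y a) (y k) < 13 / 10 * dk := by
      rw [dist_eq_norm]
      calc ‖y a - y k‖ = ‖(s - p') - ((s - p') - (y a - y k))‖ := by congr 1; abel
        _ ≤ ‖s - p'‖ + ‖(s - p') - (y a - y k)‖ := norm_sub_le _ _
        _ ≤ dist s p' + 2 * ε' := by rw [dist_eq_norm]; linarith
        _ < 13 / 10 * dk := by linarith
    set t : ↥{z : EuclideanSpace ℝ (Fin 3) | z ∈ Set.range y ∧ z ≠ y k ∧ dist z (y k) < 13 / 10 * dk} :=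
      ⟨y a, ⟨a, rfl⟩, hak, halt⟩ with ht
    refine ⟨((e t : ↥Pat) : EuclideanSpace ℝ (Fin 3)), (e t).2, ?_⟩
    have h3 := hclose t
    rw [dist_eq_norm]
    calc ‖(s - p') - dk • A ((e t : ↥Pat) : EuclideanSpace ℝ (Fin 3))‖
        = ‖((s - p') - (y a - y k)) + ((y a - y k) - dk • A ((e t : ↥Pat) : EuclideanSpace ℝ (Fin 3)))‖ := by
          congr 1; abel
      _ ≤ ‖(s - p') - (y a - y k)‖ + ‖(y a - y k) - dk • A ((e t : ↥Pat) : EuclideanSpace ℝ (Fin 3))‖ := norm_add_le _ _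
      _ ≤ 2 * ε' + dk / 8 := add_le_add h2 h3
      _ ≤ dk / 8 + ε := by linarith

/-- **Fine shells are `R₈`-dense in a texture-charged configuration (deterministic).**  Let `μ = count|S` be a rooted
`δ`-hard-core configuration (`δ > 0`) with two distinct atoms `p`, `p₂`, texture-charged in the sense of clause (d) of the
crux with fine radius `R₈` (only the separation of the approximants, their clause (4) «a `1/8`-good site within `R₈` of
every site of the `R`-ball» and the two matching clauses are assumed).  Then for every `ε > 0` there is an atom `p'` with
`dist p' p ≤ R₈ + ε` carrying a two-sided `(1/8 + ε)`-fcc-or-hcp shell at a scale `d ≥ 7/10` which is its nearest-neighbour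
distance up to `ε`: some linear isometry `A` puts an atom within `d/8 + ε` of `p' + d•A u` for every pattern point `u`, and
every atom `s ≠ p'` with `dist s p' ≤ 13/10·d − ε` within `d/8 + ε` of some `p' + d•A u`.  Proof: match the ball of radius
`R = 23/10·(|R₈| + dist p₂ p + 1) + |R₈| + 1` around `p` with tolerance `min (ε/4) (δ/4) (1/4)`, take the good site `k` within
`R₈` of the centre and its matched atom `p'`, bound the scale of `k` by `|R₈| + dist p₂ p + 1` through the matches of `p` and
`p₂`, and run `shell_transfer_core`. [folklore] -/
theorem fineShell_of_texture {δ : ℝ} (hδ : 0 < δ) {μ : Measure (EuclideanSpace ℝ (Fin 3))} (hμ : IsRootedHardCore δ μ)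
    {R₈ : ℝ}
    (h : ∀ q : EuclideanSpace ℝ (Fin 3), μ {q} ≠ 0 → ∀ R ε : ℝ, 0 < ε → ∃ (N : ℕ) (y : Fin N → EuclideanSpace ℝ (Fin 3)) (i : Fin N),
      (∀ a b : Fin N, a ≠ b → (7 : ℝ) / 10 ≤ dist (y a) (y b)) ∧
      (∀ j : Fin N, dist (y j) (y i) ≤ R → ∃ k : Fin N, dist (y k) (y j) ≤ R₈ ∧
        ∃ A : EuclideanSpace ℝ (Fin 3) →ₗᵢ[ℝ] EuclideanSpace ℝ (Fin 3),
          (∃ e : ↥{z : EuclideanSpace ℝ (Fin 3) | z ∈ Set.range y ∧ z ≠ y k ∧ dist z (y k) < 13 / 10 * sInf ((fun z => dist z (y k)) '' (Set.range y \ {y k}))} ≃ ↥Literature.Geometry.DiscreteGeometry.fccKissingPattern, ∀ t : ↥{z : EuclideanSpace ℝ (Fin 3) | z ∈ Set.range y ∧ z ≠ y k ∧ dist z (y k) < 13 / 10 * sInf ((fun z => dist z (y k)) '' (Set.range y \ {y k}))}, dist ((sInf ((fun z => dist z (y k)) '' (Set.range y \ {y k})))⁻¹ • ((t : EuclideanSpace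 ℝ (Fin 3)) - y k)) (A ((e t : ↥Literature.Geometry.DiscreteGeometry.fccKissingPattern) : EuclideanSpace ℝ (Fin 3))) ≤ 1 / 8) ∨
          (∃ e : ↥{z : EuclideanSpace ℝ (Fin 3) | z ∈ Set.range y ∧ z ≠ y k ∧ dist z (y k) < 13 / 10 * sInf ((fun z => dist z (y k)) '' (Set.range y \ {y k}))} ≃ ↥Literature.Geometry.DiscreteGeometry.hcpKissingPattern, ∀ t : ↥{z : EuclideanSpace ℝ (Fin 3) | z ∈ Set.range y ∧ z ≠ y k ∧ dist z (y k) < 13 / 10 * sInf ((fun z => dist z (y k)) '' (Set.range y \ {y k}))}, dist ((sInf ((fun z => dist z (y k)) '' (Set.range y \ {y k})))⁻¹ • ((t : EuclideanSpace ℝ (Fin 3)) - y k)) (A ((e t : ↥Literature.Geometry.DiscreteGeometry.hcpKissingPattern) : EuclideanSpace ℝ (Fin 3))) ≤ 1 / 8)) ∧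
      (∀ s : EuclideanSpace ℝ (Fin 3), μ {s} ≠ 0 → dist s q ≤ R → ∃ a : Fin N, dist (y a - y i) (s - q) ≤ ε) ∧
      (∀ a : Fin N, dist (y a) (y i) ≤ R → ∃ s : EuclideanSpace ℝ (Fin 3), μ {s} ≠ 0 ∧ dist (y a - y i) (s - q) ≤ ε))
    {p p₂ : EuclideanSpace ℝ (Fin 3)} (hp : μ {p} ≠ 0) (hp₂ : μ {p₂} ≠ 0) (hne : p₂ ≠ p) {ε : ℝ} (hε : 0 < ε) :
    ∃ p' : EuclideanSpace ℝ (Fin 3), μ {p'} ≠ 0 ∧ dist p' p ≤ R₈ + ε ∧ ∃ d : ℝ, (7 : ℝ) / 10 ≤ d ∧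
      (∀ s : EuclideanSpace ℝ (Fin 3), μ {s} ≠ 0 → s ≠ p' → d ≤ dist s p' + ε) ∧
      ∃ A : EuclideanSpace ℝ (Fin 3) →ₗᵢ[ℝ] EuclideanSpace ℝ (Fin 3),
        ((∀ u ∈ Literature.Geometry.DiscreteGeometry.fccKissingPattern, ∃ s : EuclideanSpace ℝ (Fin 3), μ {s} ≠ 0 ∧ dist (s - p') (d • A u) ≤ d / 8 + ε) ∧
          (∀ s : EuclideanSpace ℝ (Fin 3), μ {s} ≠ 0 → s ≠ p' → dist s p' + ε ≤ 13 / 10 * d →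
            ∃ u ∈ Literature.Geometry.DiscreteGeometry.fccKissingPattern, dist (s - p') (d • A u) ≤ d / 8 + ε)) ∨
        ((∀ u ∈ Literature.Geometry.DiscreteGeometry.hcpKissingPattern, ∃ s : EuclideanSpace ℝ (Fin 3), μ {s} ≠ 0 ∧ dist (s - p') (d • A u) ≤ d / 8 + ε) ∧
          (∀ s : EuclideanSpace ℝ (Fin 3), μ {s} ≠ 0 → s ≠ p' → dist s p' + ε ≤ 13 / 10 * d →
            ∃ u ∈ Literature.Geometry.DiscreteGeometry.hcpKissingPattern, dist (s - p') (d • A u) ≤ d / 8 + ε)) := by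
  obtain ⟨S, -, hS, rfl⟩ := hμ
  have hmem : ∀ q : EuclideanSpace ℝ (Fin 3),
      (Measure.count : Measure (EuclideanSpace ℝ (Fin 3))).restrict S {q} ≠ 0 ↔ q ∈ S :=
    count_restrict_singleton_ne_zero_iff S
  have hpS : p ∈ S := (hmem p).1 hp
  have hp₂S : p₂ ∈ S := (hmem p₂).1 hp₂
  set D : ℝ := dist p₂ p with hD
  have hDδ : δ ≤ D := hS p₂ hp₂S p hpS hne
  have hD0 : 0 ≤ D := dist_nonneg
  set ε' : ℝ := min (min (ε / 4) (δ / 4)) (1 / 4) with hε'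
  have hε'pos : 0 < ε' := lt_min (lt_min (by linarith) (by linarith)) (by norm_num)
  have h4ε' : 4 * ε' ≤ ε := by
    have : ε' ≤ ε / 4 := (min_le_left _ _).trans (min_le_left _ _)
    linarith
  have h2ε' : 2 * ε' < δ := by
    have : ε' ≤ δ / 4 := (min_le_left _ _).trans (min_le_right _ _)
    linarith
  have hε'1 : ε' ≤ 1 / 4 := min_le_right _ _
  set B : ℝ := |R₈| + D + 1 with hB
  have hR₈abs : R₈ ≤ |R₈| := le_abs_self R₈
  have habs0 : 0 ≤ |R₈| := abs_nonneg R₈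
  set R : ℝ := 13 / 10 * B + B + |R₈| + 1 with hRdef
  have hR0 : 0 ≤ R := by positivity
  obtain ⟨N, y, i, hsepY, hcl4, hm1, hm2⟩ := h p hp R ε' hε'pos
  have hm1' : ∀ s ∈ S, dist s p ≤ R → ∃ a : Fin N, dist (y a - y i) (s - p) ≤ ε' :=
    fun s hs => hm1 s ((hmem s).2 hs)
  have hm2' : ∀ a : Fin N, dist (y a) (y i) ≤ R → ∃ s ∈ S, dist (y a - y i) (s - p) ≤ ε' := fun a ha => by
    obtain ⟨s, hs, h⟩ := hm2 a ha
    exact ⟨s, (hmem s).1 hs, h⟩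
  -- the good site within `R₈` of the centre and its matched atom
  obtain ⟨k, hki, A, hA⟩ := hcl4 i (by rw [dist_self]; exact hR0)
  have hR₈0 : 0 ≤ R₈ := dist_nonneg.trans hki
  have hkR : dist (y k) (y i) ≤ R := by
    have : B ≥ 1 := by linarith
    linarith
  obtain ⟨p', hp'S, hk⟩ := hm2' k hkR
  have hp'p : dist p' p ≤ R₈ + ε' := by
    rw [dist_eq_norm]
    calc ‖p' - p‖ = ‖((p' - p) - (y k - y i)) + (y k - y i)‖ := by congr 1; abel
      _ ≤ ‖(p' - p) - (y k - y i)‖ + ‖y k - y i‖ := norm_add_le _ _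
      _ ≤ ε' + R₈ := add_le_add (by rw [← dist_eq_norm, dist_comm]; exact hk) (by rw [← dist_eq_norm]; exact hki)
      _ = R₈ + ε' := by ring
  -- the scale of `k` is at most `B`
  set dk : ℝ := sInf ((fun z => dist z (y k)) '' (Set.range y \ {y k})) with hdk
  have hDbdd : BddBelow ((fun z => dist z (y k)) '' (Set.range y \ {y k})) :=
    ⟨0, by rintro b ⟨z, -, rfl⟩; exact dist_nonneg⟩
  have hdk_le : ∀ a : Fin N, y a ≠ y k → dk ≤ dist (y a) (y k) :=
    fun a ha => csInf_le hDbdd ⟨y a, ⟨⟨a, rfl⟩, ha⟩, rfl⟩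
  have hdkB : dk ≤ B := by
    obtain ⟨a₁, ha₁⟩ := hm1' p hpS (by rw [dist_self]; exact hR0)
    obtain ⟨a₂, ha₂⟩ := hm1' p₂ hp₂S (by linarith : dist p₂ p ≤ R)
    rw [sub_self, dist_eq_norm, sub_zero] at ha₁
    rw [dist_eq_norm] at ha₂
    have hyk : ‖y k - y i‖ ≤ R₈ := by rw [← dist_eq_norm]; exact hki
    by_cases h1 : y a₁ ≠ y k
    · have := hdk_le a₁ h1
      have h2 : dist (y a₁) (y k) ≤ ε' + R₈ := by
        rw [dist_eq_norm]
        calc ‖y a₁ - y k‖ = ‖(y a₁ - y i) - (y k - y i)‖ := by congr 1; abel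
          _ ≤ ‖y a₁ - y i‖ + ‖y k - y i‖ := norm_sub_le _ _
          _ ≤ ε' + R₈ := add_le_add ha₁ hyk
      linarith
    · by_cases h2 : y a₂ ≠ y k
      · have := hdk_le a₂ h2
        have hkp : ‖(y k - y i) - (p' - p)‖ ≤ ε' := by rw [← dist_eq_norm]; exact hk
        have h3 : dist (y a₂) (y k) ≤ ε' + (D + (R₈ + ε')) + ε' := by
          rw [dist_eq_norm]
          calc ‖y a₂ - y k‖ = ‖((y a₂ - y i) - (p₂ - p)) + ((p₂ - p) - (p' - p)) - ((y k - y i) - (p' - p))‖ := by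
                congr 1; abel
            _ ≤ ‖(y a₂ - y i) - (p₂ - p)‖ + ‖(p₂ - p) - (p' - p)‖ + ‖(y k - y i) - (p' - p)‖ := norm_sub_le_of_le (norm_add_le _ _) le_rfl
            _ ≤ ε' + (D + (R₈ + ε')) + ε' := by
                refine add_le_add (add_le_add ha₂ ?_) hkp
                have : ‖(p₂ - p) - (p' - p)‖ = dist p₂ p' := by rw [dist_eq_norm]; congr 1; abel
                rw [this]
                calc dist p₂ p' ≤ dist p₂ p + dist p p' := dist_triangle _ _ _
                  _ ≤ D + (R₈ + ε') := add_le_add le_rfl (by rw [dist_comm]; exact hp'p)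
        linarith
      · exfalso
        push Not at h1 h2
        rw [h1] at ha₁
        rw [h2] at ha₂
        have h3 : ‖p₂ - p‖ ≤ ε' + ε' := by
          calc ‖p₂ - p‖ = ‖(y k - y i) - ((y k - y i) - (p₂ - p))‖ := by congr 1; abel
            _ ≤ ‖y k - y i‖ + ‖(y k - y i) - (p₂ - p)‖ := norm_sub_le _ _
            _ ≤ ε' + ε' := add_le_add ha₁ ha₂
        rw [← dist_eq_norm] at h3
        linarith
  have hRB : 13 / 10 * B + B + R₈ + 1 ≤ R := by linarith
  refine ⟨p', (hmem p').2 hp'S, by linarith, dk, ?_⟩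
  rcases hA with ⟨e, he⟩ | ⟨e, he⟩
  · obtain ⟨h7, hnn, hone, htwo⟩ := shell_transfer_core hS hsepY hm1' hm2' hp'S hk hki hε h2ε' h4ε' hdk hdkB hRB
      fccKissingPattern_nonempty e he
    exact ⟨h7, fun s hs => hnn s ((hmem s).1 hs), A, Or.inl
      ⟨fun u hu => by obtain ⟨s, hs, h⟩ := hone u hu; exact ⟨s, (hmem s).2 hs, h⟩,
        fun s hs => htwo s ((hmem s).1 hs)⟩⟩
  · obtain ⟨h7, hnn, hone, htwo⟩ := shell_transfer_core hS hsepY hm1' hm2' hp'S hk hki hε h2ε' h4ε' hdk hdkB hRB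
      hcpKissingPattern_nonempty e he
    exact ⟨h7, fun s hs => hnn s ((hmem s).1 hs), A, Or.inr
      ⟨fun u hu => by obtain ⟨s, hs, h⟩ := hone u hu; exact ⟨s, (hmem s).2 hs, h⟩,
        fun s hs => htwo s ((hmem s).1 hs)⟩⟩

/-- **Clauses (a) + (d) of the crux ⟹ almost surely fine shells within `R₈ + ε` of every atom** (law level, the crux's
`let`-bound `Gy` / `TexBall` / `Appr` VERBATIM).  For every `δ > 0`, every law `P` with `P`-a.s. rooted `δ`-hard-core
configurations and every choice of texture radii `R₇ R₈ R₉` with `P`-a.s. `Appr μ R₇ R₈ R₉`: `P`-almost surely, for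
every `ε > 0` and all distinct atoms `p₂ ≠ p`, there is an atom `p'` with `dist p' p ≤ R₈ + ε` carrying a two-sided
`(1/8 + ε)`-fcc/hcp shell at a nearest-neighbour scale `d ≥ 7/10` (`fineShell_of_texture`). [folklore] -/
theorem ae_fineShell_of_texture :
    ∀ P : MeasureTheory.Measure (MeasureTheory.Measure (EuclideanSpace ℝ (Fin 3))), let Gy : ℝ → (N : ℕ) → (Fin N → EuclideanSpace ℝ (Fin 3)) → Fin N → Prop := fun η N y j => let d : ℝ := sInf ((fun z => dist z (y (j : Fin N))) '' (Set.range (y) \ {(y (j : Fin N))})); let T : Set (EuclideanSpace ℝ (Fin 3)) := {z : EuclideanSpace ℝ (Fin 3) | z ∈ Set.range (y) ∧ z ≠ (y (j : Fin N)) ∧ dist z (y (j : Fin N)) < 13 / 10 * d}; ∃ A : EuclideanSpace ℝ (Fin 3) →ₗᵢ[ℝ] EuclideanSpace ℝ (Fin 3), (∃ e : ↥T ≃ ↥Literature.Geometry.DiscreteGeometry.fccKissingPattern, ∀ t : ↥T, dist (d⁻¹ • ((t : EuclideanSpace ℝ (Fin 3)) - (y (j : Fin N)))) (A ((e t : ↥Literature.Geometry.DiscreteGeometry.fccKissingPattern)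 : EuclideanSpace ℝ (Fin 3))) ≤ η) ∨ (∃ e : ↥T ≃ ↥Literature.Geometry.DiscreteGeometry.hcpKissingPattern, ∀ t : ↥T, dist (d⁻¹ • ((t : EuclideanSpace ℝ (Fin 3)) - (y (j : Fin N)))) (A ((e t : ↥Literature.Geometry.DiscreteGeometry.hcpKissingPattern) : EuclideanSpace ℝ (Fin 3))) ≤ η); let TexBall : (N : ℕ) → (Fin N → EuclideanSpace ℝ (Fin 3)) → Fin N → ℝ → ℝ → ℝ → ℝ → Prop := fun N y i R R₇ R₈ R₉ => (∀ a b : Fin N, a ≠ b → (7 : ℝ) / 10 ≤ dist (y a) (y b)) ∧ (∀ j : Fin N, dist (y j) (y i) ≤ R → ¬ Gy (1 / 20) N (y) j) ∧ (∀ j : Fin N, dist (y j) (y i) ≤ R → ¬ ((∀ j' : Fin N, dist (y j') (y j) ≤ R₇ → ¬ Gy (1 / 20) N (y) j') ∧ (∀ z : EuclideanSpace ℝ (Fin 3), dist z (y j) ≤ R₇ → ∃ k : Fin N, dist z (y k) ≤ 1) ∧ (∀ j' : Fin N, dist (y j') (y j) ≤ R₇ → (let d : ℝ := sInf ((fun z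 => dist z (y j')) '' (Set.range (y) \ {(y j')})); ∀ k : Fin N, y k ≠ y j' → dist (y k) (y j') < 27 / 20 * d → 5 ≤ Nat.card {m : Fin N // y m ≠ y j' ∧ dist (y m) (y j') < 27 / 20 * d ∧ y m ≠ y k ∧ dist (y m) (y k) < 27 / 20 * d})))) ∧ (∀ j : Fin N, dist (y j) (y i) ≤ R → ∃ k : Fin N, dist (y k) (y j) ≤ R₈ ∧ Gy (1 / 8) N (y) k) ∧ (∀ j : Fin N, dist (y j) (y i) ≤ R → ¬ ((∀ j' : Fin N, dist (y j') (y j) ≤ R₉ → ¬ Gy (1 / 20) N (y) j') ∧ (Nat.card {j' : Fin N // dist (y j') (y j) ≤ R₉ ∧ ¬ Gy (1 / 8) N (y) j'} : ℝ) ≤ 1 / 2 * (Nat.card {j' : Fin N // dist (y j') (y j) ≤ R₉} : ℝ) ∧ (∀ j' : Fin N, dist (y j') (y j) ≤ R₉ → ¬ Gy (1 / 8) N (y) j' → ¬ (let d : ℝ := sInf ((fun z => dist z (y j')) '' (Set.range (y) \ {(y j')})); ∀ k : Fin N, y k ≠ y j' → dist (y k) (y j') < 27 / 20 * d → 5 ≤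 Nat.card {m : Fin N // y m ≠ y j' ∧ dist (y m) (y j') < 27 / 20 * d ∧ y m ≠ y k ∧ dist (y m) (y k) < 27 / 20 * d})))); let Appr : MeasureTheory.Measure (EuclideanSpace ℝ (Fin 3)) → ℝ → ℝ → ℝ → Prop := fun μ R₇ R₈ R₉ => ∀ q : EuclideanSpace ℝ (Fin 3), μ {q} ≠ 0 → ∀ R ε : ℝ, 0 < ε → ∃ (N : ℕ) (y : Fin N → EuclideanSpace ℝ (Fin 3)) (i : Fin N), TexBall N y i R R₇ R₈ R₉ ∧ (∀ p : EuclideanSpace ℝ (Fin 3), μ {p} ≠ 0 → dist p q ≤ R → ∃ k : Fin N, dist (y k - y i) (p - q) ≤ ε) ∧ (∀ k : Fin N, dist (y k) (y i) ≤ R → ∃ p : EuclideanSpace ℝ (Fin 3), μ {p} ≠ 0 ∧ dist (y k - y i) (p - q) ≤ ε);  ∀ δ : ℝ, 0 < δ → (∀ᵐ μ ∂P, Literature.Probability.Process.IsRootedHardCore δ μ) → ∀ R₇ R₈ R₉ : ℝ, (∀ᵐ μ ∂P, Appr μ R₇ R₈ R₉) →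
      ∀ᵐ μ ∂P, ∀ ε : ℝ, 0 < ε → ∀ p p₂ : EuclideanSpace ℝ (Fin 3), μ {p} ≠ 0 → μ {p₂} ≠ 0 → p₂ ≠ p →
        ∃ p' : EuclideanSpace ℝ (Fin 3), μ {p'} ≠ 0 ∧ dist p' p ≤ R₈ + ε ∧ ∃ d : ℝ, (7 : ℝ) / 10 ≤ d ∧
          (∀ s : EuclideanSpace ℝ (Fin 3), μ {s} ≠ 0 → s ≠ p' → d ≤ dist s p' + ε) ∧
          ∃ A : EuclideanSpace ℝ (Fin 3) →ₗᵢ[ℝ] EuclideanSpace ℝ (Fin 3),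
            ((∀ u ∈ Literature.Geometry.DiscreteGeometry.fccKissingPattern, ∃ s : EuclideanSpace ℝ (Fin 3), μ {s} ≠ 0 ∧ dist (s - p') (d • A u) ≤ d / 8 + ε) ∧
              (∀ s : EuclideanSpace ℝ (Fin 3), μ {s} ≠ 0 → s ≠ p' → dist s p' + ε ≤ 13 / 10 * d →
                ∃ u ∈ Literature.Geometry.DiscreteGeometry.fccKissingPattern, dist (s - p') (d • A u) ≤ d / 8 + ε)) ∨
            ((∀ u ∈ Literature.Geometry.DiscreteGeometry.hcpKissingPattern, ∃ s : EuclideanSpace ℝ (Fin 3), μ {s} ≠ 0 ∧ dist (s - p') (d • A u) ≤ d / 8 + ε) ∧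
              (∀ s : EuclideanSpace ℝ (Fin 3), μ {s} ≠ 0 → s ≠ p' → dist s p' + ε ≤ 13 / 10 * d →
                ∃ u ∈ Literature.Geometry.DiscreteGeometry.hcpKissingPattern, dist (s - p') (d • A u) ≤ d / 8 + ε)) := by
  intro P
  dsimp only
  intro δ hδ ha R₇ R₈ R₉ hd
  filter_upwards [ha, hd] with μ hμ hμ' ε hε p p₂ hp hp₂ hne
  refine fineShell_of_texture hδ hμ (R₈ := R₈) (fun q hq R ε' hε' => ?_) hp hp₂ hne hε
  obtain ⟨N, y, i, ⟨hsep, -, -, h4, -⟩, hm1, hm2⟩ := hμ' q hq R ε' hε'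
  exact ⟨N, y, i, hsep, h4, hm1, hm2⟩

end Summit.AtomisticToContinuum.Crystallization.Theorems.FrustratedLawDichotomyTextureFineShells

end
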